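import Literature.Computability.MetaComplexity.PolynomialCalculus
import Summits.PneNP.PneNP.Theorems.ExpanderLinearGeneratorsPolyCalcClauses
import HarnessLib

/-!
# Polynomial calculus over characteristic `≠ 2` needs degree `> c r / 4` on expanding XOR-CNFs

Support file for item `stmt-PneNP-11444` (`LinearGeneratorModPFregeHard`, the `AC⁰[p]`-Frege
rung of route `ExpanderLinearGenerators`): the POLYNOMIAL CALCULUS RUNG beneath it.  The
algebraic proof system underlying `F_d(MOD_p)` (Buss et al. 1997: `F_d(MOD_p)` proofs translate
into low-degree Nullstellensatz refutations with extension polynomials) is the polynomial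
calculus over `𝔽_p`; without extension polynomials its degree lower bound on the route's family
is KNOWN, and this file kernel-checks it in the abstract form from which the route corollary
(`…LinearGeneratorModPFregeHardPolyCalc.lean`) follows:

**Theorem** (`not_refutableInDegree_cnfPolys`; Ben-Sasson–Impagliazzo 2010 §4 (PC over
characteristic `≠ 2` versus Gaussian width) / Alekhnovich–Razborov 2003 (the case of `𝔽₂`-linear
systems) / Buss–Grigoriev–Impagliazzo–Pitassi 2001 §4–5 (Tseitin mod 2 in characteristic `≠ 2`)).  Let `K` be a field with `2 ≠ 0`, `g : ι → ParityVec` a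
family of scope vectors with `±1` signs `b : ι → K` which is `(r, c)`-vector expanding (`c > 0`,
`r ≥ 2`), and `φ` a CNF each of whose clauses `C` is nonempty and sits on the family
(`clauseVec C = g i`, `clauseSignK C = b i` for some `i` — e.g. the `2^{ℓ-1}` clauses of the
canonical CNF of the XOR constraint `i`).  Then for `4d ≤ c r` there is no PC/`K`-refutation of
the clause polynomials `{unsatPolyK C : C ∈ φ}` (Krajíček's translation (6.0.1), Boolean axioms
included in `PC.DerivableInDegree`) of degree `≤ d`.

**Proof** (BGIP's "`R`-operator" argument in Grigoriev's pseudo-moment language).  With the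
`K`-valued pseudo-moments `Ẽ = pseudoMomentK g b r (2d)` of `…PolyCalcSigns.lean`, call
`v ∈ K[ParityVec]` SOUND (`soundSpace`) if its monomials have `≤ d` variables and all shifted
moments `L_U(v) = Σ_T v_T Ẽ[y_{U+T}]`, `|U| ≤ d`, vanish.  Sound elements form a subspace not
containing `1` (`L_0(1) = Ẽ[1] = 1`); the arithmetisation `phiK` (`x_v ↦ (1-y_v)/2`) of every
clause polynomial is sound (the complement pairing, `…PolyCalcClauses.lean`), Booleanity maps to
`0`, and — the heart — soundness survives multiplication by a variable inside the degree bound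
(`phiXK_mul_mem`): `x_j · v ↦ (v - y_j v)/2`, and `L_U(y_j v) = L_{U + e_j}(v)` vanishes either
by soundness (`|U + e_j| ≤ d`) or, when `|U + e_j| = d + 1`, by PIVOTING through any monomial
`T₁` of `v` with `T₁ + U + e_j` derivable (`pseudoMomentK_pivot`: `Ẽ[y_{T+U+e_j}] =
Ẽ[y_{T+T₁}] Ẽ[y_{T₁+U+e_j}]`, so the sum is `Ẽ[y_{T₁+U+e_j}] · L_{T₁}(v) = 0`).  Induction on
`PC.DerivableInDegree` (the multiplication rule decomposed into variables as in the tree's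
`PolynomialCalculusProofs.lean`) shows every derivable line is sound; `1` is not.

Sources: E. Ben-Sasson, R. Impagliazzo, *Random CNF's are hard for the polynomial calculus*,
Comput. Complexity 19 (2010) 501–519, §4; M. Alekhnovich, A. Razborov, *Lower bounds for
polynomial calculus: non-binomial case*, Proc. Steklov Inst. 242 (2003) 18–35 (linear systems over `𝔽₂`);
S. Buss, D. Grigoriev, R. Impagliazzo, T. Pitassi, *Linear gaps between degrees for the
polynomial calculus modulo distinct primes*, JCSS 62 (2001) 267–289, §4; J. Krajíček, *Proof
Complexity* (CUP 2019), §6.2 (PC), (6.0.1), §16.1–16.2.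
-/

noncomputable section

set_option linter.dupNamespace false -- `Summit.PneNP.PneNP.…`: summit = sub-problem (D-0017)

namespace Summit.PneNP.PneNP.Theorems.PolyCalc

open Finset MvPolynomial Literature.Computability.Complexity Literature.Computability.MetaComplexity
open scoped symmDiff

variable {K : Type*} [Field K] {ι : Type*}

/-! ### Shifted moments and the sound subspace -/

section Defs

variable (g : ι → ParityVec) (b : ι → K) (r : ℝ) (d : ℕ)

/-- The SHIFTED MOMENT functional `L_U(v) = Σ_T v_T Ẽ[y_{U+T}]` (pseudo-moments of degree
`2d`), i.e. `v ↦ L(y_U · v)`. [Buss–Grigoriev–Impagliazzo–Pitassi 2001, §4; Grigoriev 2001, §2]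
[folklore] -/
def shiftedMoment (U : ParityVec) : ParityAlgK K →ₗ[K] K :=
  momentFunctionalK (pseudoMomentK g b r (2 * d)) ∘ₗ LinearMap.mulLeft K (ymon U (1 : K))

/-- The SOUND SUBSPACE `W_d ⊆ K[ParityVec]`: elements whose monomials have at most `d` variables
and all of whose shifted moments `L_U`, `|U| ≤ d`, vanish. (The image under the arithmetisation
of every line of a low-degree PC derivation lies here; `1` does not.)
[Buss–Grigoriev–Impagliazzo–Pitassi 2001, §4 (the kernel of the operator `R`);
Ben-Sasson–Impagliazzo 2010, §4] [folklore] -/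
def soundSpace : Submodule K (ParityAlgK K) where
  carrier := {v | (∀ T ∈ v.coeff.support, T.support.card ≤ d) ∧
    ∀ U : ParityVec, U.support.card ≤ d → shiftedMoment g b r d U v = 0}
  add_mem' := fun {v w} hv hw =>
    ⟨fun T hT => by
      rw [AddMonoidAlgebra.coeff_add] at hT
      rcases Finset.mem_union.1 (Finsupp.support_add hT) with h | h
      exacts [hv.1 T h, hw.1 T h],
    fun U hU => by rw [map_add, hv.2 U hU, hw.2 U hU, add_zero]⟩
  zero_mem' := ⟨fun T hT => by simp at hT, fun U _ => map_zero _⟩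
  smul_mem' := fun a v hv =>
    ⟨fun T hT => hv.1 T (by
      rw [AddMonoidAlgebra.coeff_smul] at hT
      exact Finsupp.support_smul hT),
    fun U hU => by rw [map_smul, hv.2 U hU, smul_zero]⟩

/-- Unfolding membership in the sound subspace. [folklore] -/
theorem mem_soundSpace {v : ParityAlgK K} : v ∈ soundSpace g b r d ↔
    (∀ T ∈ v.coeff.support, T.support.card ≤ d) ∧
      ∀ U : ParityVec, U.support.card ≤ d → shiftedMoment g b r d U v = 0 := Iff.rfl

end Defs

variable {g : ι → ParityVec} {b : ι → K} {r c : ℝ} {d : ℕ}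

/-- The shifted moment as a sum over the monomials. [folklore] -/
theorem shiftedMoment_apply (U : ParityVec) (v : ParityAlgK K) :
    shiftedMoment g b r d U v =
      ∑ T ∈ v.coeff.support, v.coeff T * pseudoMomentK g b r (2 * d) (U + T) := by
  show momentFunctionalK _ (ymon U (1 : K) * v) = _
  rw [momentFunctionalK_single_mul]
  exact Finset.sum_congr rfl fun T _ => by rw [one_mul]

/-- The shifted moment of a translate `y_S · v`. [folklore] -/
theorem shiftedMoment_ymon_mul (U S : ParityVec) (v : ParityAlgK K) :
    shiftedMoment g b r d U (ymon S (1 : K) * v) =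
      ∑ T ∈ v.coeff.support, v.coeff T * pseudoMomentK g b r (2 * d) (U + S + T) := by
  show momentFunctionalK _ (ymon U (1 : K) * (ymon S (1 : K) * v)) = _
  rw [← mul_assoc, ymon_mul, one_mul, momentFunctionalK_single_mul]
  exact Finset.sum_congr rfl fun T _ => by rw [one_mul]

variable [DecidableEq ι]

/-- **`1` is not sound**: `L_0(1) = Ẽ[1] = 1`. [Buss–Grigoriev–Impagliazzo–Pitassi 2001, §4]
[folklore] -/
theorem one_notMem_soundSpace (hexp : VecExpands g r c) (hc : 0 < c)
    (hd : ((2 * d : ℕ) : ℝ) ≤ c * r / 2) (hr : 0 ≤ r) : (1 : ParityAlgK K) ∉ soundSpace g b r d := by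
  intro h
  have h0 := h.2 0 (by simp)
  rw [shiftedMoment_apply, AddMonoidAlgebra.one_def, AddMonoidAlgebra.coeff_single,
    Finsupp.support_single _ one_ne_zero, Finset.sum_singleton, Finsupp.single_eq_same,
    add_zero, pseudoMomentK_zero hexp hc hd hr, one_mul] at h0
  exact one_ne_zero h0

/-- **Clause polynomials are sound**: for a nonempty clause `C` of length `≤ d` sitting at index
`i` of the family, `phiK (unsatPolyK C) ∈ W_d` (degree control + the complement pairing).
[Buss–Grigoriev–Impagliazzo–Pitassi 2001, §4; Ben-Sasson–Impagliazzo 2010, §4] [folklore] -/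
theorem phiK_unsatPolyK_mem_soundSpace (h2 : (2 : K) ≠ 0) (hexp : VecExpands g r c) (hc : 0 < c)
    (hd : ((2 * d : ℕ) : ℝ) ≤ c * r / 2) (hr : 2 ≤ r) (hb : ∀ i, b i * b i = 1) (C : Clause ℕ)
    (hC : 0 < C.length) (hCd : C.length ≤ d) (i : ι) (hgi : g i = clauseVec C)
    (hbi : b i = clauseSignK K C) : phiK K (unsatPolyK K C) ∈ soundSpace g b r d := by
  refine ⟨fun T hT => (card_support_le_totalDegree_phiK _ hT).trans ?_, fun U hU => ?_⟩
  · rw [totalDegree_unsatPolyK]; exact hCd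
  · show momentFunctionalK _ (ymon U (1 : K) * phiK K (unsatPolyK K C)) = 0
    rw [show ymon U (1 : K) * phiK K (unsatPolyK K C) = phiK K (unsatPolyK K C) * ymon U (1 : K) from
      mul_comm _ _]
    refine momentFunctionalK_phiK_unsatPolyK_mul h2 hexp hc hd hr hb C hC i hgi hbi _
      fun U' hU' => ?_
    rw [AddMonoidAlgebra.coeff_single] at hU'
    have := Finsupp.support_single_subset hU'
    rw [Finset.mem_singleton] at this
    subst this
    omega

/-! ### The multiplication step -/

/-- **Shifted moments of a translate vanish.** If `v` is sound and all translates `T + e_j` of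
its monomials are short, then `L_U(y_j · v) = 0` for `|U| ≤ d`: either `|U + e_j| ≤ d`
(soundness at `U + e_j`) or one pivots through a monomial `T₁` of `v` with `T₁ + U + e_j`
derivable (`pseudoMomentK_pivot`), reducing to `L_{T₁}(v) = 0`.
[Buss–Grigoriev–Impagliazzo–Pitassi 2001, §4–5 (the operator `R`); Ben-Sasson–Impagliazzo 2010,
§4] [folklore] -/
theorem shiftedMoment_ymon_mul_eq_zero (hexp : VecExpands g r c) (hc : 0 < c)
    (hd : ((2 * d : ℕ) : ℝ) ≤ c * r / 2) (hb : ∀ i, b i * b i = 1) {v : ParityAlgK K}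
    (hv : v ∈ soundSpace g b r d) (e : ParityVec)
    (hshort : ∀ T ∈ v.coeff.support, (T + e).support.card ≤ d) (U : ParityVec)
    (hU : U.support.card ≤ d) : shiftedMoment g b r d U (ymon e (1 : K) * v) = 0 := by
  rw [shiftedMoment_ymon_mul]
  by_cases hUe : (U + e).support.card ≤ d
  · have := hv.2 (U + e) hUe
    rwa [shiftedMoment_apply] at this
  · by_cases hex : ∃ T₁ ∈ v.coeff.support, Derivable g r (2 * d) (T₁ + (U + e))
    · obtain ⟨T₁, hT₁, hD⟩ := hex
      have key : ∀ T ∈ v.coeff.support, pseudoMomentK g b r (2 * d) (U + e + T) =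
          pseudoMomentK g b r (2 * d) (T + T₁) * pseudoMomentK g b r (2 * d) (T₁ + (U + e)) := by
        intro T hT
        rw [show U + e + T = T + (U + e) from add_comm _ _]
        refine pseudoMomentK_pivot hexp hc hd hb hD ?_ ?_
        · have := card_support_add_le T T₁
          have h1 := hv.1 T hT
          have h3 := hv.1 T₁ hT₁
          omega
        · rw [show T + (U + e) = (T + e) + U from by abel]
          have := card_support_add_le (T + e) U
          have h1 := hshort T hT
          omega
      calc ∑ T ∈ v.coeff.support, v.coeff T * pseudoMomentK g b r (2 * d) (U + e + T)
          = (∑ T ∈ v.coeff.support, v.coeff T * pseudoMomentK g b r (2 * d) (T₁ + T)) *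
              pseudoMomentK g b r (2 * d) (T₁ + (U + e)) := by
            rw [Finset.sum_mul]
            refine Finset.sum_congr rfl fun T hT => ?_
            rw [key T hT, add_comm T T₁]
            ring
        _ = 0 := by
            have := hv.2 T₁ (hv.1 T₁ hT₁)
            rw [shiftedMoment_apply] at this
            rw [this, zero_mul]
    · push Not at hex
      refine Finset.sum_eq_zero fun T hT => ?_
      rw [show U + e + T = T + (U + e) from add_comm _ _, pseudoMomentK_of_not (hex T hT), mul_zero]

/-- `(1 - y_j)/2 · v` in terms of the translate. [folklore] -/
theorem phiXK_mul_eq (j : ℕ) (v : ParityAlgK K) :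
    phiXK (K := K) j * v = (1 / 2 : K) • (v - ymon (Finsupp.single j 1) (1 : K) * v) := by
  rw [phiXK, smul_mul_assoc, sub_mul, one_mul]

/-- The translate in terms of `(1 - y_j)/2 · v` (`2 ≠ 0`). [folklore] -/
theorem ymon_mul_eq (h2 : (2 : K) ≠ 0) (j : ℕ) (v : ParityAlgK K) :
    ymon (Finsupp.single j 1) (1 : K) * v = v - (2 : K) • (phiXK j * v) := by
  rw [phiXK_mul_eq, smul_smul, mul_one_div_cancel h2, one_smul, sub_sub_cancel]

/-- **Soundness survives multiplication by `(1 - y_j)/2`** as long as the product's monomials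
stay short. [Buss–Grigoriev–Impagliazzo–Pitassi 2001, §4–5; Ben-Sasson–Impagliazzo
2010, §4] [folklore] -/
theorem phiXK_mul_mem (h2 : (2 : K) ≠ 0) (hexp : VecExpands g r c) (hc : 0 < c)
    (hd : ((2 * d : ℕ) : ℝ) ≤ c * r / 2) (hb : ∀ i, b i * b i = 1) {v : ParityAlgK K}
    (hv : v ∈ soundSpace g b r d) (j : ℕ)
    (hdeg : ∀ T ∈ (phiXK j * v).coeff.support, T.support.card ≤ d) :
    phiXK j * v ∈ soundSpace g b r d := by
  classical
  set e : ParityVec := Finsupp.single j 1 with he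
  -- translates of monomials of `v` are short
  have hshort : ∀ T ∈ v.coeff.support, (T + e).support.card ≤ d := by
    intro T hT
    have hcoef : (ymon e (1 : K) * v).coeff (T + e) = v.coeff T := by
      rw [coeff_ySingle_mul, add_comm T e, ParityVec.add_add_cancel_left]
    have hmem : T + e ∈ (ymon e (1 : K) * v).coeff.support := by
      rw [Finsupp.mem_support_iff, hcoef]
      exact Finsupp.mem_support_iff.1 hT
    rw [he, ymon_mul_eq h2 j v, AddMonoidAlgebra.coeff_sub, AddMonoidAlgebra.coeff_smul] at hmem
    rcases Finset.mem_union.1 (Finsupp.support_sub hmem) with h | h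
    · exact hv.1 _ h
    · exact hdeg _ (Finsupp.support_smul h)
  -- monomials of the translate are short
  have hmon : ∀ T ∈ (ymon e (1 : K) * v).coeff.support, T.support.card ≤ d := by
    intro T hT
    rw [Finsupp.mem_support_iff, coeff_ySingle_mul] at hT
    have hT' : e + T ∈ v.coeff.support := Finsupp.mem_support_iff.2 hT
    have := hshort (e + T) hT'
    rwa [add_comm e T, add_assoc, ParityVec.add_self, add_zero] at this
  rw [phiXK_mul_eq]
  exact Submodule.smul_mem _ _ (Submodule.sub_mem _ hv
    ⟨hmon, fun U hU => shiftedMoment_ymon_mul_eq_zero hexp hc hd hb hv e hshort U hU⟩)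

/-- **Soundness survives multiplication by a variable within the degree bound**:
`phiK (x_j f) ∈ W_d` if `phiK f ∈ W_d` and `deg f + 1 ≤ d`. [Buss–Grigoriev–Impagliazzo–Pitassi
2001, §4–5] [folklore] -/
theorem phiK_X_mul_mem (h2 : (2 : K) ≠ 0) (hexp : VecExpands g r c) (hc : 0 < c)
    (hd : ((2 * d : ℕ) : ℝ) ≤ c * r / 2) (hb : ∀ i, b i * b i = 1) {f : MvPolynomial ℕ K}
    (hf : phiK K f ∈ soundSpace g b r d) (j : ℕ) (hdeg : f.totalDegree + 1 ≤ d) :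
    phiK K (X j * f) ∈ soundSpace g b r d := by
  rw [map_mul, phiK_X]
  refine phiXK_mul_mem h2 hexp hc hd hb hf j fun T hT => ?_
  rw [← phiK_X, ← map_mul] at hT
  refine (card_support_le_totalDegree_phiK _ hT).trans ?_
  calc (X j * f).totalDegree ≤ (X j : MvPolynomial ℕ K).totalDegree + f.totalDegree :=
        totalDegree_mul _ _
    _ ≤ d := by rw [totalDegree_X]; omega

/-- … by a power of a variable. [folklore] -/
theorem phiK_X_pow_mul_mem (h2 : (2 : K) ≠ 0) (hexp : VecExpands g r c) (hc : 0 < c)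
    (hd : ((2 * d : ℕ) : ℝ) ≤ c * r / 2) (hb : ∀ i, b i * b i = 1) (j : ℕ) :
    ∀ (n : ℕ) {f : MvPolynomial ℕ K}, phiK K f ∈ soundSpace g b r d →
      f.totalDegree + n ≤ d → phiK K (X j ^ n * f) ∈ soundSpace g b r d
  | 0, f, hf, _ => by simpa using hf
  | n + 1, f, hf, hdeg => by
    rw [pow_succ', mul_assoc]
    refine phiK_X_mul_mem h2 hexp hc hd hb (phiK_X_pow_mul_mem h2 hexp hc hd hb j n hf (by omega))
      j ?_
    have h1 := totalDegree_mul (X j ^ n) f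
    have h2' := totalDegree_pow (X j : MvPolynomial ℕ K) n
    have h3 : (X j : MvPolynomial ℕ K).totalDegree = 1 := totalDegree_X j
    rw [h3, mul_one] at h2'
    omega

/-- … by a monomial. [folklore] -/
theorem phiK_monomial_mul_mem (h2 : (2 : K) ≠ 0) (hexp : VecExpands g r c) (hc : 0 < c)
    (hd : ((2 * d : ℕ) : ℝ) ≤ c * r / 2) (hb : ∀ i, b i * b i = 1) (s : ℕ →₀ ℕ) :
    ∀ {f : MvPolynomial ℕ K}, phiK K f ∈ soundSpace g b r d →
      f.totalDegree + (s.sum fun _ k => k) ≤ d → phiK K (monomial s 1 * f) ∈ soundSpace g b r d := by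
  induction s using Finsupp.induction with
  | zero =>
    intro f hf _
    simpa using hf
  | single_add a n s ha hn ih =>
    intro f hf hdeg
    have hsum : ((Finsupp.single a n + s).sum fun _ k => k) = n + s.sum fun _ k => k := by
      rw [Finsupp.sum_add_index' (fun _ => rfl) (fun _ _ _ => rfl), Finsupp.sum_single_index rfl]
    rw [hsum] at hdeg
    rw [monomial_single_add, mul_assoc]
    refine phiK_X_pow_mul_mem h2 hexp hc hd hb a n (ih hf (by omega)) ?_
    have h1 := totalDegree_mul (monomial s (1 : K)) f
    have h2' := totalDegree_monomial_le s (1 : K)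
    simp only [Function.id_def] at h2'
    omega

/-! ### Soundness of low-degree PC derivations, and the theorem -/

/-- **Every line of a degree-`≤ d` PC derivation from the clause polynomials is sound** (all
clauses nonempty and sitting on the expanding family; `4d ≤ c r`, `r ≥ 2`, `2 ≠ 0` in `K`).
[Buss–Grigoriev–Impagliazzo–Pitassi 2001, §4–5; Ben-Sasson–Impagliazzo 2010, §4]
[folklore] -/
theorem phiK_mem_soundSpace_of_derivable (h2 : (2 : K) ≠ 0) (hexp : VecExpands g r c)
    (hc : 0 < c) (hd : ((2 * d : ℕ) : ℝ) ≤ c * r / 2) (hr : 2 ≤ r) (hb : ∀ i, b i * b i = 1)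
    {φ : CNF ℕ} (hφ : ∀ C ∈ φ, 0 < C.length ∧ ∃ i, g i = clauseVec C ∧ b i = clauseSignK K C)
    {f : MvPolynomial ℕ K} (hf : PC.DerivableInDegree (cnfPolys K φ) d f) :
    phiK K f ∈ soundSpace g b r d := by
  induction hf with
  | hyp hmem hdeg =>
    obtain ⟨C, hC, rfl⟩ := hmem
    obtain ⟨hlen, i, hgi, hbi⟩ := hφ C hC
    rw [totalDegree_unsatPolyK] at hdeg
    exact phiK_unsatPolyK_mem_soundSpace h2 hexp hc hd hr hb C hlen hdeg i hgi hbi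
  | booleanAxiom j _ =>
    rw [phiK_boolAxiom h2]
    exact zero_mem _
  | add _ _ ihf ihg =>
    rw [map_add]
    exact add_mem ihf ihg
  | @mul f h _ hdfh ih =>
    by_cases hf0 : f = 0
    · rw [hf0, zero_mul, map_zero]; exact zero_mem _
    by_cases hh0 : h = 0
    · rw [hh0, mul_zero, map_zero]; exact zero_mem _
    have hdeg : f.totalDegree + h.totalDegree ≤ d := by
      rw [← totalDegree_mul_of_isDomain hf0 hh0]; exact hdfh
    rw [h.as_sum, Finset.mul_sum, map_sum]
    refine sum_mem fun s hs => ?_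
    have : f * monomial s (coeff s h) = coeff s h • (monomial s 1 * f) := by
      rw [mul_comm, ← smul_mul_assoc, smul_monomial, smul_eq_mul, mul_one]
    rw [this, map_smul]
    refine Submodule.smul_mem _ _ (phiK_monomial_mul_mem h2 hexp hc hd hb s ih ?_)
    exact (Nat.add_le_add_left (le_totalDegree hs) _).trans hdeg

/-- **Polynomial calculus degree lower bound for expanding XOR-CNFs** (Ben-Sasson–Impagliazzo /
Alekhnovich–Razborov / Buss–Grigoriev–Impagliazzo–Pitassi, vector-expansion form).  Over a field
`K` with `2 ≠ 0`: if the clauses of `φ` are nonempty and sit on an `(r, c)`-vector-expanding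
family of XOR constraints (`c > 0`, `r ≥ 2`), then for every `d` with `4d ≤ c r` the clause
polynomials of `φ` have NO PC/`K`-refutation of degree `≤ d`.
[Ben-Sasson–Impagliazzo 2010, §4; Alekhnovich–Razborov 2003 (linear systems over `𝔽₂`);
Buss–Grigoriev–Impagliazzo–Pitassi 2001, §4–5] [folklore] -/
theorem not_refutableInDegree_cnfPolys (h2 : (2 : K) ≠ 0) (hexp : VecExpands g r c) (hc : 0 < c)
    (hr : 2 ≤ r) (hd : ((2 * d : ℕ) : ℝ) ≤ c * r / 2) (hb : ∀ i, b i * b i = 1) {φ : CNF ℕ}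
    (hφ : ∀ C ∈ φ, 0 < C.length ∧ ∃ i, g i = clauseVec C ∧ b i = clauseSignK K C) :
    ¬ PC.RefutableInDegree (cnfPolys K φ) d := by
  intro h
  have h1 := phiK_mem_soundSpace_of_derivable h2 hexp hc hd hr hb hφ h
  rw [map_one] at h1
  exact one_notMem_soundSpace hexp hc hd (by linarith) h1

end Summit.PneNP.PneNP.Theorems.PolyCalc
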